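import Mathlib
import Literature.NumberTheory.Sieve.Maynard2016Histogram
import HarnessLib

/-!
# Maynard 2016, Lemma 8: histogram density (proved) — Lemma 8 becomes a theorem

Topic `Literature/NumberTheory/Sieve`. J. Maynard, *Large gaps between primes*, Ann. of Math. (2)
183 (2016), 915–933 = arXiv:1408.5110, §8, proof of Lemma 8, approximation step ("such functions
are dense").

We PROVE the named fact `HistDensity` of `Maynard2016Histogram`: a measurable `G(t) = F(10t)`,
`F : ℝ^k → [0,1]` supported in `R_k`, is `L¹`-approximated on the orthant by histograms
`Σ_{a good} c_a 1_{Q_a}` with `c_a ∈ [0,1]` on the good open cells of mesh `h = 1/(10m)`.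

Proof. Take a continuous `C` with `‖G − C‖_{L¹(ℝ^k)} ≤ δ/3`
(`Integrable.exists_hasCompactSupport_integral_sub_le`); `C` is uniformly continuous on the box
`[0,1/10]^k`, so for `h` small `|C(centre of Q_a) − C(t)| < δ/3` on `Q_a`; put
`c_a = clip_{[0,1]} C(centre of Q_a)` (`|clip x − y| ≤ |x − y|` for `y ∈ [0,1]`). Off the null union
of grid hyperplanes `{t_ℓ = jh}` (`Measure.pi_hyperplane`) every point of the box lies in an open
cell `Q_a` with `a_ℓ < m`; on a good cell `|c_a − G| ≤ δ/3 + |C − G|`, and on a bad cell the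
histogram vanishes while `G ≤ 1_{L_m}`, `L_m = {t ∈ box : 1/10 − kh ≤ Σ t_ℓ ≤ 1/10}`. The layers
`L_m` decrease to a subset of the face `{Σ t_ℓ = 1/10}`, which is Lebesgue-null (Fubini through
`secEquiv`), so `vol(L_m) → 0` (`tendsto_measure_iInter_atTop`). Hence
`∫_{t ≥ 0} |S − G| ≤ δ/3·vol(box) + ‖C − G‖₁ + vol(L_m) ≤ δ`.

Consequences (all PROVED here, discharging the named facts of the reduction ladder):
`histDensity_holds`, `l1DensityOrth_holds`, `l1DensityBdd_holds`, `scaledDensityBdd_holds`,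
`lemma8F_holds`, **`lemma8_holds : Lemma8`**, and
**`theorem1_of_lemma7 : Lemma7 → Maynard2016_theorem1`**: Maynard's Theorem 1 now rests on the
single named input `Lemma7` (§7, from Lemma 6 and Bombieri–Vinogradov).

## References

* J. Maynard, *Large gaps between primes*, Ann. of Math. (2) 183 (2016), 915–933; arXiv:1408.5110,
  Lemma 8 (proof). [Maynard2016LargeGaps]
-/

open Filter Finset MeasureTheory Set
open scoped Topology

namespace Literature.NumberTheory.Sieve

namespace Maynard2016

/-! ### The box `[0,1/10]^k` -/

/-- The box `[0,1/10]^k` containing `(1/10) R_k`. [cite: Maynard2016LargeGaps, Lemma 8 (proof)] -/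
def tenthBox (k : ℕ) : Set (Fin k → ℝ) := Set.univ.pi fun _ : Fin k => Set.Icc (0 : ℝ) (1 / 10)

/-- The box is measurable. [cite: Maynard2016LargeGaps, Lemma 8 (proof)] -/
theorem measurableSet_tenthBox (k : ℕ) : MeasurableSet (tenthBox k) :=
  MeasurableSet.univ_pi fun _ => measurableSet_Icc

/-- The box is compact. [cite: Maynard2016LargeGaps, Lemma 8 (proof)] -/
theorem isCompact_tenthBox (k : ℕ) : IsCompact (tenthBox k) :=
  isCompact_univ_pi fun _ => isCompact_Icc

/-- The box lies in the orthant. [cite: Maynard2016LargeGaps, Lemma 8 (proof)] -/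
theorem tenthBox_subset_orthant (k : ℕ) :
    tenthBox k ⊆ Set.univ.pi fun _ : Fin k => Set.Ici (0 : ℝ) :=
  Set.pi_mono fun _ _ => Set.Icc_subset_Ici_self

/-- The box has finite volume. [cite: Maynard2016LargeGaps, Lemma 8 (proof)] -/
theorem volume_tenthBox_ne_top' (k : ℕ) : volume (tenthBox k) ≠ ⊤ := volume_tenthBox_ne_top k

/-- `vol([0,1/10]^k) ≤ 1`. [cite: Maynard2016LargeGaps, Lemma 8 (proof)] -/
theorem volume_real_tenthBox_le_one (k : ℕ) : volume.real (tenthBox k) ≤ 1 := by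
  unfold tenthBox
  rw [measureReal_def, volume_pi_pi]
  simp only [Real.volume_Icc, sub_zero]
  rw [ENNReal.toReal_prod]
  simp only [ENNReal.toReal_ofReal (by norm_num : (0 : ℝ) ≤ 1 / 10), Finset.prod_const,
    Finset.card_univ, Fintype.card_fin]
  exact pow_le_one₀ (by norm_num) (by norm_num)

/-! ### The function `G(t) = F(10t)` -/

/-- `F(10t) = 0` off the box `[0,1/10]^k`. [cite: Maynard2016LargeGaps, Lemma 8 (proof)] -/
theorem scaled_eq_zero_of_not_mem_tenthBox {k : ℕ} {F : (Fin k → ℝ) → ℝ}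
    (hFs : Function.support F ⊆ maynardSimplex k) {t : Fin k → ℝ} (ht : t ∉ tenthBox k) :
    F ((10 : ℝ) • t) = 0 := by
  obtain ⟨ℓ, hℓ⟩ : ∃ ℓ, t ℓ ∉ Set.Icc (0 : ℝ) (1 / 10) := by
    by_contra h
    exact ht (Set.mem_univ_pi.2 fun ℓ => not_not.1 fun hn => h ⟨ℓ, hn⟩)
  rw [Set.mem_Icc, not_and_or] at hℓ
  rcases hℓ with h1 | h1
  · exact apply_eq_zero_of_not_mem_Icc hFs (ℓ := ℓ) (by
      simp only [Pi.smul_apply, smul_eq_mul, Set.mem_Icc, not_and_or, not_le]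
      exact Or.inl (by linarith [not_le.1 h1]))
  · exact scaled_eq_zero_of_lt hFs (not_le.1 h1)

/-- `F(10t) ≠ 0` forces `Σ t_ℓ ≤ 1/10`. [cite: Maynard2016LargeGaps, Lemma 8 (proof)] -/
theorem sum_le_of_scaled_ne_zero {k : ℕ} {F : (Fin k → ℝ) → ℝ}
    (hFs : Function.support F ⊆ maynardSimplex k) {t : Fin k → ℝ} (h : F ((10 : ℝ) • t) ≠ 0) :
    ∑ ℓ, t ℓ ≤ 1 / 10 := by
  have hmem : (10 : ℝ) • t ∈ maynardSimplex k := hFs (Function.mem_support.2 h)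
  have h2 := hmem.2
  simp only [Pi.smul_apply, smul_eq_mul] at h2
  rw [← Finset.mul_sum] at h2
  linarith

/-- `F(10t)` is integrable on `ℝ^k`. [cite: Maynard2016LargeGaps, Lemma 8 (proof)] -/
theorem integrable_scaled {k : ℕ} {F : (Fin k → ℝ) → ℝ} (hFm : Measurable F)
    (hFs : Function.support F ⊆ maynardSimplex k) (hF01 : ∀ t, 0 ≤ F t ∧ F t ≤ 1) :
    Integrable (fun t : Fin k → ℝ => F ((10 : ℝ) • t)) := by
  refine (integrableOn_scaled_orthant hFm hFs hF01).integrable_of_forall_notMem_eq_zero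
    fun t ht => ?_
  obtain ⟨ℓ, hℓ⟩ : ∃ ℓ, t ℓ < 0 := by
    by_contra h
    exact ht (Set.mem_univ_pi.2 fun ℓ => Set.mem_Ici.2 (not_lt.1 fun hlt => h ⟨ℓ, hlt⟩))
  exact apply_eq_zero_of_not_mem_Icc hFs (ℓ := ℓ) (by
    simp only [Pi.smul_apply, smul_eq_mul, Set.mem_Icc, not_and_or, not_le]
    exact Or.inl (by linarith))

/-! ### The face `{Σ t_ℓ = s}` is null; the layers shrink to it -/

/-- A hyperplane `{Σ_ℓ t_ℓ = s}` in `ℝ^{n+1}` is Lebesgue-null. [cite: Maynard2016LargeGaps, Lemma 8 (proof)] -/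
theorem volume_face_eq_zero (n : ℕ) (s : ℝ) :
    volume {t : Fin (n + 1) → ℝ | ∑ ℓ, t ℓ = s} = 0 := by
  have hes : MeasurePreserving (secEquiv (0 : Fin (n + 1))).symm volume volume :=
    (measurePreserving_secEquiv (0 : Fin (n + 1))).symm _
  have hmeas : MeasurableSet {t : Fin (n + 1) → ℝ | ∑ ℓ, t ℓ = s} :=
    measurableSet_eq_fun (Finset.measurable_sum _ fun ℓ _ => measurable_pi_apply ℓ)
      measurable_const
  rw [← hes.measure_preimage hmeas.nullMeasurableSet]
  have hpre : (secEquiv (0 : Fin (n + 1))).symm ⁻¹' {t : Fin (n + 1) → ℝ | ∑ ℓ, t ℓ = s} =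
      {p : ℝ × (Fin n → ℝ) | p.1 + ∑ j, p.2 j = s} := by
    ext p
    simp only [Set.mem_preimage, Set.mem_setOf_eq, secEquiv_symm_apply]
    rw [Fin.sum_univ_succAbove _ (0 : Fin (n + 1)), Fin.insertNth_apply_same]
    simp only [Fin.insertNth_apply_succAbove]
  rw [hpre]
  have hmeas2 : MeasurableSet {p : ℝ × (Fin n → ℝ) | p.1 + ∑ j, p.2 j = s} :=
    measurableSet_eq_fun (measurable_fst.add
      (Finset.measurable_sum _ fun j _ => (measurable_pi_apply j).comp measurable_snd))
      measurable_const
  rw [show (volume : Measure (ℝ × (Fin n → ℝ))) = volume.prod volume from rfl,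
    Measure.prod_apply_symm hmeas2]
  have hsec : ∀ y : Fin n → ℝ,
      (fun x : ℝ => (x, y)) ⁻¹' {p : ℝ × (Fin n → ℝ) | p.1 + ∑ j, p.2 j = s} = {s - ∑ j, y j} := by
    intro y
    ext x
    simp only [Set.mem_preimage, Set.mem_setOf_eq, Set.mem_singleton_iff]
    constructor <;> intro h <;> linarith
  simp only [hsec, measure_singleton, lintegral_zero]

/-- The face layer `L_m = {t ∈ [0,1/10]^k : 1/10 − kh ≤ Σ t_ℓ ≤ 1/10}`, `h = 1/(10m)`.
[cite: Maynard2016LargeGaps, Lemma 8 (proof)] -/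
def layer (k m : ℕ) : Set (Fin k → ℝ) :=
  {t | t ∈ tenthBox k ∧ (1 / 10 - (k : ℝ) * gridH m ≤ ∑ ℓ, t ℓ ∧ ∑ ℓ, t ℓ ≤ 1 / 10)}

/-- Layers are measurable. [cite: Maynard2016LargeGaps, Lemma 8 (proof)] -/
theorem measurableSet_layer (k m : ℕ) : MeasurableSet (layer k m) := by
  have hs : Measurable fun t : Fin k → ℝ => ∑ ℓ, t ℓ :=
    Finset.measurable_sum _ fun ℓ _ => measurable_pi_apply ℓ
  have h1 : layer k m = tenthBox k ∩ ({t | 1 / 10 - (k : ℝ) * gridH m ≤ ∑ ℓ, t ℓ} ∩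
      {t | ∑ ℓ, t ℓ ≤ 1 / 10}) := by
    ext t
    simp only [layer, Set.mem_setOf_eq, Set.mem_inter_iff]
  rw [h1]
  exact (measurableSet_tenthBox k).inter
    ((measurableSet_le measurable_const hs).inter (measurableSet_le hs measurable_const))

/-- `m ↦ L_{m+1}` is decreasing. [cite: Maynard2016LargeGaps, Lemma 8 (proof)] -/
theorem layer_succ_antitone (k : ℕ) : Antitone fun m : ℕ => layer k (m + 1) := by
  intro m m' hmm' t ht
  refine ⟨ht.1, ?_, ht.2.2⟩
  have hle : gridH (m' + 1) ≤ gridH (m + 1) := by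
    unfold gridH
    push_cast
    exact one_div_le_one_div_of_le (by positivity) (by
      have : (m : ℝ) ≤ m' := by exact_mod_cast hmm'
      linarith)
  have hk : (0 : ℝ) ≤ k := Nat.cast_nonneg k
  have := ht.2.1
  nlinarith [mul_le_mul_of_nonneg_left hle hk]

/-- `⋂_m L_{m+1} ⊆ {Σ t_ℓ = 1/10}`. [cite: Maynard2016LargeGaps, Lemma 8 (proof)] -/
theorem iInter_layer_subset (n : ℕ) :
    (⋂ m : ℕ, layer (n + 1) (m + 1)) ⊆ {t : Fin (n + 1) → ℝ | ∑ ℓ, t ℓ = 1 / 10} := by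
  intro t ht
  rw [Set.mem_iInter] at ht
  have hle : ∑ ℓ, t ℓ ≤ 1 / 10 := (ht 0).2.2
  by_contra hne
  have hlt : ∑ ℓ, t ℓ < 1 / 10 := lt_of_le_of_ne hle hne
  have hgap : 0 < 1 / 10 - ∑ ℓ, t ℓ := by linarith
  obtain ⟨m, hm⟩ := exists_nat_gt (((n : ℝ) + 1) / (10 * (1 / 10 - ∑ ℓ, t ℓ)))
  have h1 := (ht m).2.1
  push_cast at h1
  have hm' : (n : ℝ) + 1 < (m : ℝ) * (10 * (1 / 10 - ∑ ℓ, t ℓ)) :=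
    (div_lt_iff₀ (by positivity)).1 hm
  have h2 : ((n : ℝ) + 1) * gridH (m + 1) < 1 / 10 - ∑ ℓ, t ℓ := by
    unfold gridH
    push_cast
    rw [show ((n : ℝ) + 1) * (1 / (10 * ((m : ℝ) + 1))) = ((n : ℝ) + 1) / (10 * ((m : ℝ) + 1)) by
      ring, div_lt_iff₀ (by positivity)]
    nlinarith
  linarith

/-- **`vol(L_m) → 0`**: some `m₁` with `vol(L_{m+1}) < ε` for all `m ≥ m₁`. [cite: Maynard2016LargeGaps, Lemma 8 (proof)] -/
theorem exists_layer_small (n : ℕ) {ε : ℝ} (hε : 0 < ε) :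
    ∃ m₁ : ℕ, ∀ m, m₁ ≤ m → volume.real (layer (n + 1) (m + 1)) < ε := by
  have hT := tendsto_measure_iInter_atTop (μ := (volume : Measure (Fin (n + 1) → ℝ)))
    (s := fun m : ℕ => layer (n + 1) (m + 1))
    (fun m => (measurableSet_layer _ _).nullMeasurableSet) (layer_succ_antitone (n + 1))
    ⟨0, measure_ne_top_of_subset (fun t ht => ht.1) (volume_tenthBox_ne_top' (n + 1))⟩
  have h0 : volume (⋂ m : ℕ, layer (n + 1) (m + 1)) = 0 :=
    measure_mono_null (iInter_layer_subset n) (volume_face_eq_zero n (1 / 10))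
  rw [h0] at hT
  have hev := (tendsto_order.1 hT).2 (ENNReal.ofReal ε) (ENNReal.ofReal_pos.2 hε)
  obtain ⟨m₁, hm₁⟩ := Filter.eventually_atTop.1 hev
  exact ⟨m₁, fun m hm => ENNReal.toReal_lt_of_lt_ofReal (hm₁ m hm)⟩

/-! ### Grid hyperplanes are null; the cell of a generic point -/

/-- The union of the grid hyperplanes `{t_ℓ = jh}`. [cite: Maynard2016LargeGaps, Lemma 8 (proof)] -/
def gridNull (k m : ℕ) : Set (Fin k → ℝ) := ⋃ ℓ : Fin k, ⋃ j : ℕ, {t | t ℓ = (j : ℝ) * gridH m}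

/-- The grid hyperplanes form a null set. [cite: Maynard2016LargeGaps, Lemma 8 (proof)] -/
theorem volume_gridNull (k m : ℕ) : volume (gridNull k m) = 0 := by
  unfold gridNull
  refine measure_iUnion_null fun ℓ => measure_iUnion_null fun j => ?_
  exact Measure.pi_hyperplane (fun _ : Fin k => (volume : Measure ℝ)) ℓ ((j : ℝ) * gridH m)

/-- The index of the cell containing `t`: `a_ℓ = ⌊t_ℓ / h⌋`. [cite: Maynard2016LargeGaps, Lemma 8 (proof)] -/
noncomputable def cellIndex {k : ℕ} (m : ℕ) (t : Fin k → ℝ) : Fin k → ℕ :=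
  fun ℓ => ⌊t ℓ / gridH m⌋₊

/-- Off the grid hyperplanes, a point of the box lies in the open cell of its index.
[cite: Maynard2016LargeGaps, Lemma 8 (proof)] -/
theorem mem_cell_cellIndex {k m : ℕ} (hm : 1 ≤ m) {t : Fin k → ℝ} (ht : t ∈ tenthBox k)
    (hN : t ∉ gridNull k m) : t ∈ cell k m (cellIndex m t) := by
  have hh := gridH_pos hm
  simp only [gridNull, Set.mem_iUnion, Set.mem_setOf_eq, not_exists] at hN
  rw [mem_cell_iff]
  intro ℓ
  have ht0 : 0 ≤ t ℓ := (Set.mem_univ_pi.1 ht ℓ).1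
  have hq : 0 ≤ t ℓ / gridH m := div_nonneg ht0 hh.le
  have hfl : ((⌊t ℓ / gridH m⌋₊ : ℕ) : ℝ) ≤ t ℓ / gridH m := Nat.floor_le hq
  have hfl2 : t ℓ / gridH m < ((⌊t ℓ / gridH m⌋₊ : ℕ) : ℝ) + 1 := Nat.lt_floor_add_one _
  have e : t ℓ / gridH m * gridH m = t ℓ := div_mul_cancel₀ _ hh.ne'
  constructor
  · show ((⌊t ℓ / gridH m⌋₊ : ℕ) : ℝ) * gridH m < t ℓ
    have hle : ((⌊t ℓ / gridH m⌋₊ : ℕ) : ℝ) * gridH m ≤ t ℓ := by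
      have := mul_le_mul_of_nonneg_right hfl hh.le
      rwa [e] at this
    exact lt_of_le_of_ne hle (fun heq => hN ℓ ⌊t ℓ / gridH m⌋₊ heq.symm)
  · show t ℓ < (((⌊t ℓ / gridH m⌋₊ : ℕ) : ℝ) + 1) * gridH m
    have := mul_lt_mul_of_pos_right hfl2 hh
    rwa [e] at this

/-- Off the grid hyperplanes, the cell index of a point of the box is `< m`.
[cite: Maynard2016LargeGaps, Lemma 8 (proof)] -/
theorem cellIndex_lt {k m : ℕ} (hm : 1 ≤ m) {t : Fin k → ℝ} (ht : t ∈ tenthBox k)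
    (hN : t ∉ gridNull k m) (ℓ : Fin k) : cellIndex m t ℓ < m := by
  have hh := gridH_pos hm
  simp only [gridNull, Set.mem_iUnion, Set.mem_setOf_eq, not_exists] at hN
  have ht0 : 0 ≤ t ℓ := (Set.mem_univ_pi.1 ht ℓ).1
  have ht1 : t ℓ ≤ 1 / 10 := (Set.mem_univ_pi.1 ht ℓ).2
  have hne : t ℓ ≠ (m : ℝ) * gridH m := hN ℓ m
  have hlt : t ℓ < (m : ℝ) * gridH m :=
    lt_of_le_of_ne (by rw [natCast_mul_gridH hm]; exact ht1) hne
  show ⌊t ℓ / gridH m⌋₊ < m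
  rw [Nat.floor_lt (div_nonneg ht0 hh.le), div_lt_iff₀ hh]
  exact hlt

/-! ### Values of the histogram -/

/-- Indices of good cells are `< m`. [cite: Maynard2016LargeGaps, Lemma 8 (proof)] -/
theorem lt_of_mem_goodCells {k m : ℕ} {a : Fin k → ℕ} (ha : a ∈ goodCells k m) (ℓ : Fin k) :
    a ℓ < m :=
  Finset.mem_range.1 (Fintype.mem_piFinset.1 (Finset.mem_filter.1 ha).1 ℓ)

/-- Cells with indices `< m` lie in the box. [cite: Maynard2016LargeGaps, Lemma 8 (proof)] -/
theorem cell_subset_tenthBox {k m : ℕ} (hm : 1 ≤ m) {a : Fin k → ℕ} (ha : ∀ ℓ, a ℓ < m) :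
    cell k m a ⊆ tenthBox k := by
  have hh := gridH_pos hm
  intro t ht
  rw [mem_cell_iff] at ht
  refine Set.mem_univ_pi.2 fun ℓ => ⟨?_, ?_⟩
  · have : 0 ≤ cellLo k m a ℓ := by unfold cellLo; positivity
    exact this.trans (ht ℓ).1.le
  · have h1 : a ℓ + 1 ≤ m := ha ℓ
    have h1' : (a ℓ : ℝ) + 1 ≤ m := by exact_mod_cast h1
    calc t ℓ ≤ cellHi k m a ℓ := (ht ℓ).2.le
      _ = ((a ℓ : ℝ) + 1) * gridH m := rfl
      _ ≤ (m : ℝ) * gridH m := mul_le_mul_of_nonneg_right h1' hh.le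
      _ = 1 / 10 := natCast_mul_gridH hm

/-- On the open cell `Q_a` the histogram equals `c_a` (good `a`) or `0`.
[cite: Maynard2016LargeGaps, Lemma 8 (proof)] -/
theorem histFun_eq_of_mem_cell {k m : ℕ} (hm : 1 ≤ m) (c : (Fin k → ℕ) → ℝ) {a : Fin k → ℕ}
    {t : Fin k → ℝ} (ht : t ∈ cell k m a) :
    histFun k m c t = if a ∈ goodCells k m then c a else 0 := by
  unfold histFun
  split_ifs with hg
  · rw [Finset.sum_eq_single_of_mem a hg (fun b _ hba => ?_)]
    · rw [Set.indicator_of_mem ht, mul_one]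
    · rw [Set.indicator_of_notMem (fun hb' => hba (eq_of_mem_cell hm hb' ht)), mul_zero]
  · refine Finset.sum_eq_zero fun b hb => ?_
    rw [Set.indicator_of_notMem (fun hb' => hg ?_), mul_zero]
    have e := eq_of_mem_cell hm hb' ht
    subst e
    exact hb

/-- Off the box the histogram vanishes. [cite: Maynard2016LargeGaps, Lemma 8 (proof)] -/
theorem histFun_eq_zero_of_not_mem_tenthBox {k m : ℕ} (hm : 1 ≤ m) (c : (Fin k → ℕ) → ℝ)
    {t : Fin k → ℝ} (ht : t ∉ tenthBox k) : histFun k m c t = 0 := by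
  unfold histFun
  refine Finset.sum_eq_zero fun a ha => ?_
  rw [Set.indicator_of_notMem (fun hta => ht (cell_subset_tenthBox hm (lt_of_mem_goodCells ha)
    hta)), mul_zero]

/-! ### Cell centres and clipping -/

/-- The centre `((a_ℓ + 1/2) h)_ℓ` of the cell `a`. [cite: Maynard2016LargeGaps, Lemma 8 (proof)] -/
noncomputable def cellCtr (k m : ℕ) (a : Fin k → ℕ) : Fin k → ℝ :=
  fun ℓ => ((a ℓ : ℝ) + 1 / 2) * gridH m

/-- Centres of cells with indices `< m` lie in the box. [cite: Maynard2016LargeGaps, Lemma 8 (proof)] -/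
theorem cellCtr_mem_tenthBox {k m : ℕ} (hm : 1 ≤ m) {a : Fin k → ℕ} (ha : ∀ ℓ, a ℓ < m) :
    cellCtr k m a ∈ tenthBox k := by
  have hh := gridH_pos hm
  refine Set.mem_univ_pi.2 fun ℓ => ⟨?_, ?_⟩
  · show 0 ≤ ((a ℓ : ℝ) + 1 / 2) * gridH m
    positivity
  · show ((a ℓ : ℝ) + 1 / 2) * gridH m ≤ 1 / 10
    have h1 : a ℓ + 1 ≤ m := ha ℓ
    have h1' : (a ℓ : ℝ) + 1 ≤ m := by exact_mod_cast h1
    calc ((a ℓ : ℝ) + 1 / 2) * gridH m ≤ (m : ℝ) * gridH m :=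
          mul_le_mul_of_nonneg_right (by linarith) hh.le
      _ = 1 / 10 := natCast_mul_gridH hm

/-- A point of `Q_a` is within sup-distance `h` of the centre. [cite: Maynard2016LargeGaps, Lemma 8 (proof)] -/
theorem dist_cellCtr_lt {k m : ℕ} (hm : 1 ≤ m) {a : Fin k → ℕ} {t : Fin k → ℝ}
    (ht : t ∈ cell k m a) : dist (cellCtr k m a) t < gridH m := by
  have hh := gridH_pos hm
  rw [mem_cell_iff] at ht
  refine (dist_pi_lt_iff hh).2 fun ℓ => ?_
  rw [Real.dist_eq]
  obtain ⟨h1, h2⟩ := ht ℓ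
  simp only [cellLo, cellHi] at h1 h2
  show |((a ℓ : ℝ) + 1 / 2) * gridH m - t ℓ| < gridH m
  rw [abs_sub_lt_iff]
  constructor <;> nlinarith

/-- Clipping to `[0,1]` does not increase the distance to a point of `[0,1]`.
[cite: Maynard2016LargeGaps, Lemma 8 (proof)] -/
theorem abs_clip_sub_le {x y : ℝ} (hy0 : 0 ≤ y) (hy1 : y ≤ 1) :
    |max 0 (min 1 x) - y| ≤ |x - y| := by
  rcases le_total x 0 with hx | hx
  · rw [min_eq_right (hx.trans zero_le_one), max_eq_left hx, zero_sub, abs_neg, abs_of_nonneg hy0,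
      abs_sub_comm, abs_of_nonneg (by linarith)]
    linarith
  · rcases le_total x 1 with hx1 | hx1
    · rw [min_eq_right hx1, max_eq_right hx]
    · rw [min_eq_left hx1, max_eq_right zero_le_one, abs_of_nonneg (by linarith),
        abs_of_nonneg (by linarith)]
      linarith

/-! ### Histogram density -/

/-- **Maynard 2016, Lemma 8, approximation step: `HistDensity` holds (PROVED).**
[cite: Maynard2016LargeGaps, Lemma 8 (proof, "such functions are dense")] -/
theorem histDensity_holds : HistDensity := by
  intro k hk F hFm hFs hF01 δ hδ
  obtain ⟨n, rfl⟩ : ∃ n, k = n + 1 := ⟨k - 1, by omega⟩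
  set G : (Fin (n + 1) → ℝ) → ℝ := fun t => F ((10 : ℝ) • t) with hG
  have hGi : Integrable G := integrable_scaled hFm hFs hF01
  have hG01 : ∀ t, 0 ≤ G t ∧ G t ≤ 1 := fun t => hF01 _
  -- a continuous `L¹`-approximant
  obtain ⟨C, -, hCG, hCc, hCi⟩ :=
    hGi.exists_hasCompactSupport_integral_sub_le (ε := δ / 3) (by linarith)
  -- uniform continuity of `C` on the box
  have hUC : UniformContinuousOn C (tenthBox (n + 1)) :=
    (isCompact_tenthBox _).uniformContinuousOn_of_continuous hCc.continuousOn
  obtain ⟨η, hη, hUCη⟩ := Metric.uniformContinuousOn_iff.1 hUC (δ / 3) (by linarith)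
  -- the face layer
  obtain ⟨m₁, hm₁⟩ := exists_layer_small n (ε := δ / 3) (by linarith)
  -- the mesh
  obtain ⟨m₂, hm₂⟩ := exists_nat_gt (1 / (10 * η))
  set m : ℕ := max (m₁ + 1) (max m₂ 1) with hmdef
  have hm1 : 1 ≤ m := le_trans (le_max_right m₂ 1) (le_max_right _ _)
  have hmm₁ : m₁ + 1 ≤ m := le_max_left _ _
  have hmm₂ : m₂ ≤ m := le_trans (le_max_left m₂ 1) (le_max_right _ _)
  have hh := gridH_pos hm1
  have hhη : gridH m < η := by
    have h1 : 1 / (10 * η) < (m : ℝ) := lt_of_lt_of_le hm₂ (by exact_mod_cast hmm₂)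
    unfold gridH
    rw [div_lt_iff₀ (by positivity)]
    rw [div_lt_iff₀ (by positivity)] at h1
    nlinarith
  have hlayer : volume.real (layer (n + 1) m) < δ / 3 := by
    have := hm₁ (m - 1) (by omega)
    rwa [Nat.sub_add_cancel hm1] at this
  -- the coefficients
  set c : (Fin (n + 1) → ℕ) → ℝ := fun a => max 0 (min 1 (C (cellCtr (n + 1) m a))) with hc
  have hc01 : ∀ a, 0 ≤ c a ∧ c a ≤ 1 := fun a =>
    ⟨le_max_left _ _, max_le zero_le_one (min_le_left _ _)⟩
  refine ⟨m, hm1, c, hc01, ?_⟩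
  -- sets
  set box := tenthBox (n + 1) with hbox
  set orth := Set.univ.pi fun _ : Fin (n + 1) => Set.Ici (0 : ℝ) with horth
  set L := layer (n + 1) m with hL
  have horthm : MeasurableSet orth := MeasurableSet.univ_pi fun _ => measurableSet_Ici
  have hboxm : MeasurableSet box := measurableSet_tenthBox _
  have hLm : MeasurableSet L := measurableSet_layer _ _
  have hLbox : L ⊆ box := fun t ht => ht.1
  have hboxorth : box ⊆ orth := tenthBox_subset_orthant _
  -- the pointwise bound off the grid hyperplanes
  have hpt : ∀ t, t ∉ gridNull (n + 1) m → |histFun (n + 1) m c t - G t| ≤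
      box.indicator (fun t => δ / 3 + |C t - G t|) t + L.indicator (fun _ => (1 : ℝ)) t := by
    intro t htN
    have hLi : 0 ≤ L.indicator (fun _ => (1 : ℝ)) t :=
      Set.indicator_nonneg (fun _ _ => zero_le_one) _
    by_cases htb : t ∈ box
    · have hta : t ∈ cell (n + 1) m (cellIndex m t) := mem_cell_cellIndex hm1 htb htN
      have halt : ∀ ℓ, cellIndex m t ℓ < m := cellIndex_lt hm1 htb htN
      rw [histFun_eq_of_mem_cell hm1 c hta, Set.indicator_of_mem htb]
      by_cases hgood : cellIndex m t ∈ goodCells (n + 1) m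
      · rw [if_pos hgood]
        have h1 : |c (cellIndex m t) - G t| ≤ |C (cellCtr (n + 1) m (cellIndex m t)) - G t| :=
          abs_clip_sub_le (hG01 t).1 (hG01 t).2
        have h2 : |C (cellCtr (n + 1) m (cellIndex m t)) - C t| < δ / 3 := by
          have := hUCη (cellCtr (n + 1) m (cellIndex m t)) (cellCtr_mem_tenthBox hm1 halt) t htb
            ((dist_cellCtr_lt hm1 hta).trans hhη)
          rwa [Real.dist_eq] at this
        have h3 := abs_sub_le (C (cellCtr (n + 1) m (cellIndex m t))) (C t) (G t)
        linarith
      · rw [if_neg hgood, zero_sub, abs_neg]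
        have h0 : 0 ≤ δ / 3 + |C t - G t| := by positivity
        by_cases hGz : G t = 0
        · rw [hGz, abs_zero]
          linarith [abs_nonneg (C t - 0), hLi]
        · have htL : t ∈ L := by
            refine ⟨htb, ?_, sum_le_of_scaled_ne_zero hFs hGz⟩
            have hpi : cellIndex m t ∈ Fintype.piFinset (fun _ : Fin (n + 1) => Finset.range m) :=
              Fintype.mem_piFinset.2 fun ℓ => Finset.mem_range.2 (halt ℓ)
            have hsum : ¬ (∑ ℓ, (cellIndex m t ℓ + 1) ≤ m) := fun h =>
              hgood (Finset.mem_filter.2 ⟨hpi, h⟩)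
            have hsum1 : m < ∑ ℓ, (cellIndex m t ℓ + 1) := not_le.1 hsum
            have hsum2 : (m : ℝ) < ∑ ℓ, ((cellIndex m t ℓ : ℝ) + 1) := by exact_mod_cast hsum1
            rw [Finset.sum_add_distrib, Finset.sum_const, Finset.card_univ, Fintype.card_fin,
              nsmul_eq_mul, mul_one] at hsum2
            have hcell := mem_cell_iff.1 hta
            have hlo : ∑ ℓ, (cellIndex m t ℓ : ℝ) * gridH m ≤ ∑ ℓ, t ℓ :=
              Finset.sum_le_sum fun ℓ _ => (hcell ℓ).1.le
            rw [← Finset.sum_mul] at hlo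
            have hmh := natCast_mul_gridH hm1
            have e1 : (1 : ℝ) / 10 - ((n + 1 : ℕ) : ℝ) * gridH m =
                ((m : ℝ) - ((n : ℝ) + 1)) * gridH m := by
              push_cast
              rw [sub_mul, hmh]
            have e2 : ((m : ℝ) - ((n : ℝ) + 1)) * gridH m <
                (∑ ℓ, (cellIndex m t ℓ : ℝ)) * gridH m :=
              mul_lt_mul_of_pos_right (by push_cast at hsum2; linarith) hh
            rw [e1]
            exact (e2.trans_le hlo).le
          rw [Set.indicator_of_mem htL, abs_of_nonneg (hG01 t).1]
          linarith [(hG01 t).2]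
    · have h1 : histFun (n + 1) m c t = 0 := histFun_eq_zero_of_not_mem_tenthBox hm1 c htb
      have h2 : G t = 0 := scaled_eq_zero_of_not_mem_tenthBox hFs htb
      rw [h1, h2, sub_zero, abs_zero, Set.indicator_of_notMem htb, zero_add]
      exact hLi
  -- integrability of the bound
  have hA : Integrable (fun t => |C t - G t|) := (hCi.sub hGi).abs
  have hI1 : IntegrableOn (fun t => δ / 3 + |C t - G t|) box :=
    (integrableOn_const (volume_tenthBox_ne_top' (n + 1))).add hA.integrableOn
  have hBi1 : Integrable (box.indicator fun t => δ / 3 + |C t - G t|) := by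
    rw [integrable_indicator_iff hboxm]
    exact hI1
  have hBi2 : Integrable (L.indicator fun _ => (1 : ℝ)) := by
    rw [integrable_indicator_iff hLm]
    exact integrableOn_const (measure_ne_top_of_subset hLbox (volume_tenthBox_ne_top' (n + 1)))
  -- a.e. on the orthant
  have hae : ∀ᵐ t ∂(volume.restrict orth), |histFun (n + 1) m c t - G t| ≤
      box.indicator (fun t => δ / 3 + |C t - G t|) t + L.indicator (fun _ => (1 : ℝ)) t := by
    have h2 : ∀ᵐ t ∂(volume.restrict orth), t ∉ gridNull (n + 1) m :=
      ae_restrict_of_ae (measure_eq_zero_iff_ae_notMem.1 (volume_gridNull (n + 1) m))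
    filter_upwards [h2] with t htN using hpt t htN
  have hint : ∫ t in orth, |histFun (n + 1) m c t - G t| ≤
      ∫ t in orth, (box.indicator (fun t => δ / 3 + |C t - G t|) t +
        L.indicator (fun _ => (1 : ℝ)) t) :=
    integral_mono_of_nonneg (Eventually.of_forall fun t => abs_nonneg _)
      (hBi1.add hBi2).integrableOn hae
  have hJ1 : ∫ t in orth, box.indicator (fun t => δ / 3 + |C t - G t|) t =
      ∫ t in box, (δ / 3 + |C t - G t|) := by
    rw [setIntegral_indicator hboxm, Set.inter_eq_right.2 hboxorth]
  have hJ2 : ∫ t in orth, L.indicator (fun _ => (1 : ℝ)) t = volume.real L := by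
    rw [setIntegral_indicator hLm, Set.inter_eq_right.2 (hLbox.trans hboxorth), setIntegral_const,
      smul_eq_mul, mul_one]
  have hK : IntegrableOn (fun _ : Fin (n + 1) → ℝ => δ / 3) box :=
    integrableOn_const (volume_tenthBox_ne_top' (n + 1))
  have hJ3 : ∫ t in box, (δ / 3 + |C t - G t|) ≤ δ / 3 + δ / 3 := by
    rw [integral_add hK hA.integrableOn, setIntegral_const, smul_eq_mul]
    have hv : volume.real box ≤ 1 := volume_real_tenthBox_le_one _
    have hI : ∫ t in box, |C t - G t| ≤ δ / 3 := by
      calc ∫ t in box, |C t - G t| ≤ ∫ t, |C t - G t| :=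
            setIntegral_le_integral hA (Eventually.of_forall fun t => abs_nonneg _)
        _ = ∫ t, ‖G t - C t‖ := by
            refine integral_congr_ae (Eventually.of_forall fun t => ?_)
            show |C t - G t| = ‖G t - C t‖
            rw [Real.norm_eq_abs, abs_sub_comm]
        _ ≤ δ / 3 := hCG
    have : volume.real box * (δ / 3) ≤ δ / 3 := mul_le_of_le_one_left (by positivity) hv
    linarith
  rw [integral_add hBi1.integrableOn hBi2.integrableOn, hJ1, hJ2] at hint
  linarith [hint, hJ3, hlayer]

/-- `HistDensity` — `_holds` alias of `histDensity_holds` above under the fact's exact name (appended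
2026-08-28, D-0026 bookkeeping: the proof term is the existing theorem of this file; no statement,
definition or attribute is edited; no new named fact; the ledger's debt table listed the fact
unproved). [cite: Maynard2016LargeGaps, Lemma 8 (proof, "such functions are dense")] -/
theorem _root_.Literature.NumberTheory.Sieve.Maynard2016.HistDensity_holds : HistDensity :=
  _root_.Literature.NumberTheory.Sieve.Maynard2016.histDensity_holds

/-! ### Consequences: the named facts of the Lemma 8 ladder are theorems -/

/-- `L1DensityOrth` holds. [cite: Maynard2016LargeGaps, Lemma 8 (proof)] -/
theorem l1DensityOrth_holds : L1DensityOrth := l1DensityOrth_of_histDensity histDensity_holds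

/-- `L1DensityOrth` — `_holds` alias of `l1DensityOrth_holds` above under the fact's exact name (appended
2026-08-28, D-0026 bookkeeping: the proof term is the existing theorem of this file; no statement,
definition or attribute is edited; no new named fact; the ledger's debt table listed the fact
unproved). [cite: Maynard2016LargeGaps, Lemma 8 (proof)] -/
theorem _root_.Literature.NumberTheory.Sieve.Maynard2016.L1DensityOrth_holds : L1DensityOrth :=
  _root_.Literature.NumberTheory.Sieve.Maynard2016.l1DensityOrth_holds

/-- `L1DensityBdd` holds. [cite: Maynard2016LargeGaps, Lemma 8 (proof)] -/
theorem l1DensityBdd_holds : L1DensityBdd := l1DensityBdd_of_histDensity histDensity_holds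

/-- `L1DensityBdd` — `_holds` alias of `l1DensityBdd_holds` above under the fact's exact name (appended
2026-08-28, D-0026 bookkeeping: the proof term is the existing theorem of this file; no statement,
definition or attribute is edited; no new named fact; the ledger's debt table listed the fact
unproved). [cite: Maynard2016LargeGaps, Lemma 8 (proof)] -/
theorem _root_.Literature.NumberTheory.Sieve.Maynard2016.L1DensityBdd_holds : L1DensityBdd :=
  _root_.Literature.NumberTheory.Sieve.Maynard2016.l1DensityBdd_holds

/-- `ScaledDensityBdd` holds. [cite: Maynard2016LargeGaps, Lemma 8 (proof)] -/
theorem scaledDensityBdd_holds : ScaledDensityBdd := scaledDensityBdd_of_l1DensityOrth l1DensityOrth_holds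

/-- `ScaledDensityBdd` — `_holds` alias of `scaledDensityBdd_holds` above under the fact's exact name (appended
2026-08-28, D-0026 bookkeeping: the proof term is the existing theorem of this file; no statement,
definition or attribute is edited; no new named fact; the ledger's debt table listed the fact
unproved). [cite: Maynard2016LargeGaps, Lemma 8 (proof)] -/
theorem _root_.Literature.NumberTheory.Sieve.Maynard2016.ScaledDensityBdd_holds :
    ScaledDensityBdd :=
  _root_.Literature.NumberTheory.Sieve.Maynard2016.scaledDensityBdd_holds

/-- `Lemma8F` holds. [cite: Maynard2016LargeGaps, Lemma 8] -/
theorem lemma8F_holds : Lemma8F := lemma8F_of_l1DensityBdd l1DensityBdd_holds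

/-- `Lemma8F` — `_holds` alias of `lemma8F_holds` above under the fact's exact name (appended
2026-08-28, D-0026 bookkeeping: the proof term is the existing theorem of this file; no statement,
definition or attribute is edited; no new named fact; the ledger's debt table listed the fact
unproved). [cite: Maynard2016LargeGaps, Lemma 8] -/
theorem _root_.Literature.NumberTheory.Sieve.Maynard2016.Lemma8F_holds : Lemma8F :=
  _root_.Literature.NumberTheory.Sieve.Maynard2016.lemma8F_holds

/-- **Maynard 2016, Lemma 8 (PROVED).** [cite: Maynard2016LargeGaps, Lemma 8] -/
theorem lemma8_holds : Lemma8 := lemma8_of_histDensity histDensity_holds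

/-- `Lemma8` — `_holds` alias of `lemma8_holds` above under the fact's exact name (appended
2026-08-28, D-0026 bookkeeping: the proof term is the existing theorem of this file; no statement,
definition or attribute is edited; no new named fact; the ledger's debt table listed the fact
unproved). [cite: Maynard2016LargeGaps, Lemma 8] -/
theorem _root_.Literature.NumberTheory.Sieve.Maynard2016.Lemma8_holds : Lemma8 :=
  _root_.Literature.NumberTheory.Sieve.Maynard2016.lemma8_holds

/-- `GPYMeasures` from `Lemma7` alone. [cite: Maynard2016LargeGaps, Proposition 5 (proof)] -/
theorem gpyMeasures_of_lemma7 (h7 : Lemma7) : GPYMeasures := gpyMeasures_of_lemma7_lemma8 h7 lemma8_holds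

/-- **Maynard's Theorem 1 from `Lemma7` alone.** [cite: Maynard2016LargeGaps, Theorem 1] -/
theorem theorem1_of_lemma7 (h7 : Lemma7) : Literature.NumberTheory.Sieve.Maynard2016_theorem1 :=
  theorem1_of_lemma7_histDensity h7 histDensity_holds

/-- **`∀ c, RankinConstant c` from `Lemma7` alone.** [cite: Maynard2016LargeGaps, Theorem 1] -/
theorem forall_rankinConstant_of_lemma7 (h7 : Lemma7) (c : ℝ) :
    Literature.NumberTheory.Sieve.RankinConstant c :=
  forall_rankinConstant_of_lemma7_histDensity h7 histDensity_holds c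

end Maynard2016

end Literature.NumberTheory.Sieve
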